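import Literature.NumberTheory.LFunctions.ConnesProlateGuessRHFree
import Literature.NumberTheory.LFunctions.ConnesProlateGuessFact
import HarnessLib

/-!
# CCM25 Lemma 7.2(i) proved: `max_{[−λ,λ]}|h_{n,λ} − h_n| ≤ C_n λ^{-2}` for `n = 0, 4`

Connes–Consani–Moscovici 2025, Lemma 7.2(i), eq. (7.7) (from Meixner–Schäfke 1954, §3.2 Satz 9;
Slepian 1965) states that the `L²`-normalised prolate spheroidal wave function `h_{n,λ}` with `n`
zeros converges to the Hermite function `h_n` uniformly on `[−λ, λ]` at the rate `λ^{-2}`.  In the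
tree this is the named fact `prolateSupNormRate n h_n` (`ConnesProlateGuessFact.lean`), so far used
only as a hypothesis (`prolateGuess_tendsto_riemannXi_of_supNormRate`).  THIS file proves it for
`n = 0` (`h_0`, `μ = 2π`) and `n = 4` (`h_4`, `μ = 18π`) from the eight-field interface
`IsProlateFunction` alone — no asymptotic input — with every constant explicit in the proof:

* `prolateSupNormRate_zero : prolateSupNormRate 0 hermiteH0`,
* `prolateSupNormRate_four : prolateSupNormRate 4 hermiteH4`,
* the closing `example : prolateGuess_tendsto_riemannXi` — Connes' Fact 6.4 through the printed
  route `prolateGuess_tendsto_riemannXi_of_supNormRate prolateSupNormRate_zero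
  prolateSupNormRate_four` (a second unconditional proof of the landed theorem
  `prolateGuess_tendsto_riemannXi_rhFree`, hence an `example`, not a declaration);
* by-products: the eigenvalue bounds `|χ_0(λ) − 2πλ²|, |χ_4(λ) − 18πλ²| ≤ D`
  (`IsProlateFunction.eigen_sub_le_of_zero/four`).

The argument (`prolateSupNormRate_of_uniform_limits`), for a Hermite datum `h″ = (4π²x² − μ)h`:
1. rate-free sup-closeness `max_{[−λ,λ]}|f − h| → 0` from the `W^{1,1}` limits of
   `IsProlateFunction.uniform_limits` (`supClose_of_uniform_limits`, FTC on `[x, λ]`);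
2. hence the eigenvalue bound `|χ_n(λ) − μλ²| ≤ D` (Green's identity, `eigen_sub_le_of_supClose`);
3. on a FIXED window `[0, X]`, `X = μ + D + 2`: Gronwall (`window_compare` with `δ = D/λ²`) gives
   `|f − c h|, |f′ − c h′| ≤ A₁λ^{-2}`, `c = f(0)/h(0)`;
4. on the forbidden region `[X, λ]` a maximum principle for `e = f − c h`:
   `((λ²−x²)e′)′ = ((2πλx)² − χ)e + ρ` with `(2πλx)² − χ ≥ λ²` and `|ρ| ≤ W` (`ρ` is `c` times
   `(λ²μ − χ)h + (x²h′)′`), so `|e| ≤ max(|e(X)|, |e(λ)|, Wλ^{-2})` (`abs_le_max_of_sturm`); the end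
   point value is `O(λ^{-2})` by `λ³|f(λ)| ≤ |f′(X)|` (`cube_mul_abs_apply_lam_le`, the integrated
   equation past the turning point) and `x²|h| ≤ B`;
5. the scale: `∫_0^λ f² = ½`, `∫_0^λ h² = ½ + O(λ^{-2})` and `|f − ch| = O(λ^{-2})` force
   `|c − 1| = O(λ^{-2})`.
THIS IS NOT AN RH STATEMENT; nothing here uses or approaches RH.
-/

noncomputable section

open Real Set MeasureTheory Filter Topology intervalIntegral

namespace Literature.NumberTheory.LFunctions

/-! ### A maximum principle for `(p e′)′ = V e + ρ` -/

/-- **One-sided maximum principle.**  If `e` is continuous on `[a, b]`, differentiable inside with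
`P = p·e′`, `p > 0`, `P′ = V e + ρ`, `V ≥ K > 0` and `|ρ| ≤ W` on `(a, b)`, then
`e ≤ max(e(a), e(b), W/K)` on `[a, b]`: at an interior maximum `x*` with `e(x*) > W/K` one has
`P(x*) = 0 < P′(x*)`, so `e′ > 0` just to the right of `x*`. [folklore] -/
theorem le_max_of_sturm {e e' P p V ρ : ℝ → ℝ} {a b K W : ℝ} (hab : a ≤ b)
    (hec : ContinuousOn e (Icc a b)) (hed : ∀ x ∈ Ioo a b, HasDerivAt e (e' x) x)
    (hP : ∀ x ∈ Ioo a b, P x = p x * e' x) (hp : ∀ x ∈ Ioo a b, 0 < p x)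
    (hPd : ∀ x ∈ Ioo a b, HasDerivAt P (V x * e x + ρ x) x)
    (hV : ∀ x ∈ Ioo a b, K ≤ V x) (hρ : ∀ x ∈ Ioo a b, |ρ x| ≤ W) (hK : 0 < K) (hW : 0 ≤ W) :
    ∀ x ∈ Icc a b, e x ≤ max (max (e a) (e b)) (W / K) := by
  obtain ⟨xs, hxs, hmax⟩ := isCompact_Icc.exists_isMaxOn (nonempty_Icc.2 hab) hec
  intro x hx
  refine (hmax hx).trans ?_
  by_contra hcon
  rw [not_le] at hcon
  have h1 : e a < e xs := lt_of_le_of_lt ((le_max_left _ _).trans (le_max_left _ _)) hcon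
  have h2 : e b < e xs := lt_of_le_of_lt ((le_max_right _ _).trans (le_max_left _ _)) hcon
  have h3 : W / K < e xs := lt_of_le_of_lt (le_max_right _ _) hcon
  have hxa : a < xs := by
    rcases eq_or_lt_of_le hxs.1 with h | h
    · rw [h] at h1; exact (lt_irrefl _ h1).elim
    · exact h
  have hxb : xs < b := by
    rcases eq_or_lt_of_le hxs.2 with h | h
    · rw [h] at h2; exact (lt_irrefl _ h2).elim
    · exact h
  have hxI : xs ∈ Ioo a b := ⟨hxa, hxb⟩
  -- `e′(x*) = 0`, so `P(x*) = 0`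
  have hloc : IsLocalMax e xs := hmax.isLocalMax (Icc_mem_nhds hxa hxb)
  have he'0 : e' xs = 0 := hloc.hasDerivAt_eq_zero (hed xs hxI)
  have hP0 : P xs = 0 := by rw [hP xs hxI, he'0, mul_zero]
  -- `P′(x*) > 0`
  have hd : 0 < V xs * e xs + ρ xs := by
    have hexs : 0 < e xs := lt_of_le_of_lt (div_nonneg hW hK.le) h3
    have hWK : W < K * e xs := by rwa [div_lt_iff₀ hK, mul_comm] at h3
    have hVe : K * e xs ≤ V xs * e xs := mul_le_mul_of_nonneg_right (hV xs hxI) hexs.le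
    have := neg_abs_le (ρ xs)
    have := hρ xs hxI
    linarith
  -- the slope of `P` at `x*` is eventually positive on the right
  have hslope : ∀ᶠ y in 𝓝[≠] xs, 0 < slope P xs y :=
    ((hPd xs hxI).tendsto_slope).eventually (lt_mem_nhds hd)
  have hslope' : ∀ᶠ y in 𝓝[>] xs, 0 < slope P xs y :=
    hslope.filter_mono (nhdsWithin_mono _ fun y hy ↦ ne_of_gt (mem_Ioi.1 hy))
  obtain ⟨u, hu, hsub⟩ := mem_nhdsGT_iff_exists_Ioo_subset.1 hslope'
  -- `e′ > 0` on `(x*, min u b)`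
  obtain ⟨y, hy1, hy2⟩ := exists_between (lt_min (mem_Ioi.1 hu) hxb)
  have hyu : y < u := lt_of_lt_of_le hy2 (min_le_left _ _)
  have hyb : y < b := lt_of_lt_of_le hy2 (min_le_right _ _)
  have hpos : ∀ z ∈ Ioo xs y, 0 < e' z := by
    intro z hz
    have hzI : z ∈ Ioo a b := ⟨hxa.trans hz.1, hz.2.trans hyb⟩
    have hs : 0 < slope P xs z := hsub ⟨hz.1, hz.2.trans hyu⟩
    rw [slope_def_field, hP0, sub_zero] at hs
    have hPz : 0 < P z := by
      have hzx : 0 < z - xs := by linarith [hz.1]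
      by_contra hcon'
      have : P z / (z - xs) ≤ 0 := div_nonpos_of_nonpos_of_nonneg (not_lt.1 hcon') hzx.le
      linarith
    rw [hP z hzI] at hPz
    by_contra hcon'
    rw [not_lt] at hcon'
    nlinarith [hp z hzI, hcon']
  -- mean value theorem on `[x*, y]`
  have hcy : ContinuousOn e (Icc xs y) := hec.mono (Icc_subset_Icc hxa.le hyb.le)
  have hdy : ∀ z ∈ Ioo xs y, HasDerivAt e (e' z) z := fun z hz ↦
    hed z ⟨hxa.trans hz.1, hz.2.trans hyb⟩
  obtain ⟨c, hc, hce⟩ := exists_hasDerivAt_eq_slope e e' hy1 hcy hdy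
  have hgt : e xs < e y := by
    have h := hpos c hc
    rw [hce] at h
    have hyx : 0 < y - xs := by linarith
    have := div_pos_iff.1 h
    rcases this with ⟨hnum, _⟩ | ⟨_, hden⟩
    · linarith
    · linarith
  have := hmax (show y ∈ Icc a b from ⟨(hxa.trans hy1).le, hyb.le⟩)
  exact absurd hgt (not_lt.2 this)

/-- **Two-sided maximum principle**: under the hypotheses of `le_max_of_sturm`,
`|e| ≤ max(|e(a)|, |e(b)|, W/K)` on `[a, b]`. [folklore] -/
theorem abs_le_max_of_sturm {e e' P p V ρ : ℝ → ℝ} {a b K W : ℝ} (hab : a ≤ b)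
    (hec : ContinuousOn e (Icc a b)) (hed : ∀ x ∈ Ioo a b, HasDerivAt e (e' x) x)
    (hP : ∀ x ∈ Ioo a b, P x = p x * e' x) (hp : ∀ x ∈ Ioo a b, 0 < p x)
    (hPd : ∀ x ∈ Ioo a b, HasDerivAt P (V x * e x + ρ x) x)
    (hV : ∀ x ∈ Ioo a b, K ≤ V x) (hρ : ∀ x ∈ Ioo a b, |ρ x| ≤ W) (hK : 0 < K) (hW : 0 ≤ W) :
    ∀ x ∈ Icc a b, |e x| ≤ max (max |e a| |e b|) (W / K) := by
  intro x hx
  have h1 := le_max_of_sturm hab hec hed hP hp hPd hV hρ hK hW x hx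
  have h2 := le_max_of_sturm hab (e := fun x ↦ -e x) (e' := fun x ↦ -e' x) (P := fun x ↦ -P x)
    (p := p) (V := V) (ρ := fun x ↦ -ρ x) (K := K) (W := W) hec.neg
    (fun x hx ↦ (hed x hx).neg) (fun x hx ↦ by rw [hP x hx]; ring) hp
    (fun x hx ↦ by
      have := (hPd x hx).neg
      refine this.congr_deriv ?_
      ring)
    hV (fun x hx ↦ by rw [abs_neg]; exact hρ x hx) hK hW x hx
  have m1 : max (max (e a) (e b)) (W / K) ≤ max (max |e a| |e b|) (W / K) :=
    max_le_max (max_le_max (le_abs_self _) (le_abs_self _)) le_rfl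
  have m2 : max (max (-e a) (-e b)) (W / K) ≤ max (max |e a| |e b|) (W / K) :=
    max_le_max (max_le_max (neg_le_abs _) (neg_le_abs _)) le_rfl
  rw [abs_le]
  constructor
  · linarith [h2.trans m2]
  · exact h1.trans m1

/-! ### Step 1: rate-free sup-norm closeness from the `W^{1,1}` limits -/

/-- **Sup-norm closeness from the `W^{1,1}` limits.**  If uniformly over the prolate functions `f`
with `n` zeros `λ|f(λ)| → 0` and `∫_0^λ|f′ − h′|(1+x) → 0`, `h` is even with `x²|h| ≤ B`, then
`max_{[−λ,λ]}|f − h| → 0` uniformly: `f(x) − h(x) = (f(λ) − h(λ)) − ∫_x^λ(f′ − h′)`.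
[cite: ConnesConsaniMoscovici2025, Lemma 7.2] -/
theorem IsProlateFunction.supClose_of_uniform_limits {n : ℕ} {h h' : ℝ → ℝ}
    (hh : ∀ x, HasDerivAt h (h' x) x) (hh'c : Continuous h') (heven : ∀ x, h (-x) = h x)
    {B : ℝ} (hB : ∀ x, x ^ 2 * |h x| ≤ B)
    (U : ∀ ε : ℝ, 0 < ε → ∃ Λ : ℝ, ∀ lam : ℝ, Λ ≤ lam → ∀ f : ℝ → ℝ, IsProlateFunction lam n f →
      lam * |f lam| ≤ ε ∧ (∫ x in (0 : ℝ)..lam, |f x - h x|) ≤ ε ∧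
      (∫ x in (0 : ℝ)..lam, |deriv f x - h' x| * (1 + x)) ≤ ε) :
    ∀ η : ℝ, 0 < η → ∃ Λ : ℝ, ∀ lam : ℝ, Λ ≤ lam → ∀ f : ℝ → ℝ, IsProlateFunction lam n f →
      ∀ x ∈ Icc (-lam) lam, |f x - h x| ≤ η := by
  intro η hη
  obtain ⟨Λ₁, hΛ₁⟩ := U (η / 3) (by positivity)
  have hB0 : 0 ≤ B := by simpa using hB 0
  refine ⟨max Λ₁ (3 * B / η + 1), fun lam hlam f hf ↦ ?_⟩
  have hl1 : Λ₁ ≤ lam := (le_max_left _ _).trans hlam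
  have hl2 : 3 * B / η + 1 ≤ lam := (le_max_right _ _).trans hlam
  have hlam0 := hf.lam_pos
  have hq0 : 0 ≤ 3 * B / η := by positivity
  have hlam1 : 1 ≤ lam := by linarith
  obtain ⟨hE, -, hW⟩ := hΛ₁ lam hl1 f hf
  have hfl : |f lam| ≤ η / 3 := by
    have : |f lam| ≤ lam * |f lam| := le_mul_of_one_le_left (abs_nonneg _) hlam1
    linarith
  have hhl : |h lam| ≤ η / 3 := by
    have h1 := hB lam
    have h2 : 3 * B / η ≤ lam ^ 2 := by nlinarith
    have h3 : 3 * B ≤ lam ^ 2 * η := by rwa [div_le_iff₀ hη] at h2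
    have hl2pos : 0 < lam ^ 2 := by positivity
    by_contra hcon
    rw [not_le] at hcon
    have : η / 3 * lam ^ 2 < |h lam| * lam ^ 2 := mul_lt_mul_of_pos_right hcon hl2pos
    nlinarith
  have hcf : ContinuousOn f (Icc (-lam) lam) := hf.contDiffOn.continuousOn
  have hhc : Continuous h := continuous_iff_continuousAt.2 fun y ↦ (hh y).continuousAt
  -- the claim on `[0, λ)`
  have key : ∀ x ∈ Ico 0 lam, |f x - h x| ≤ η := by
    intro x hx
    have ifd : IntervalIntegrable (deriv f) volume x lam :=
      hf.intervalIntegrable_deriv.mono_set (by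
        rw [uIcc_of_le hlam0.le, uIcc_of_le hx.2.le]; exact Icc_subset_Icc hx.1 le_rfl)
    have ih' : IntervalIntegrable h' volume x lam := hh'c.intervalIntegrable _ _
    have hFf : ∫ t in x..lam, deriv f t = f lam - f x :=
      intervalIntegral.integral_eq_sub_of_hasDeriv_right_of_le hx.2.le
        (hcf.mono (Icc_subset_Icc (by linarith [hx.1]) le_rfl))
        (fun t ht ↦ ((hf.differentiableAt ⟨by linarith [ht.1, hx.1], ht.2⟩).hasDerivAt).hasDerivWithinAt)
        ifd
    have hFh : ∫ t in x..lam, h' t = h lam - h x :=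
      intervalIntegral.integral_eq_sub_of_hasDerivAt (fun t _ ↦ hh t) ih'
    have hsub : ∫ t in x..lam, (deriv f t - h' t) = (f lam - f x) - (h lam - h x) := by
      rw [intervalIntegral.integral_sub ifd ih', hFf, hFh]
    have i01 : IntervalIntegrable (fun t ↦ |deriv f t - h' t| * (1 + t)) volume 0 lam :=
      ((hf.intervalIntegrable_deriv.sub (hh'c.intervalIntegrable _ _)).abs).mul_continuousOn
        (by fun_prop)
    have hI : |∫ t in x..lam, (deriv f t - h' t)| ≤ η / 3 := by
      calc |∫ t in x..lam, (deriv f t - h' t)|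
          ≤ ∫ t in x..lam, |deriv f t - h' t| :=
            intervalIntegral.abs_integral_le_integral_abs hx.2.le
        _ ≤ ∫ t in x..lam, |deriv f t - h' t| * (1 + t) :=
            intervalIntegral.integral_mono_on hx.2.le (ifd.sub ih').abs
              (((ifd.sub ih').abs).mul_continuousOn (by fun_prop))
              (fun t ht ↦ le_mul_of_one_le_right (abs_nonneg _) (by linarith [ht.1, hx.1]))
        _ ≤ ∫ t in (0 : ℝ)..lam, |deriv f t - h' t| * (1 + t) :=
            intervalIntegral.integral_mono_interval hx.1 hx.2.le le_rfl
              (ae_restrict_of_forall_mem measurableSet_Ioc fun t ht ↦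
                mul_nonneg (abs_nonneg _) (by linarith [ht.1]))
              i01
        _ ≤ η / 3 := hW
    have e : f x - h x = (f lam - h lam) - ∫ t in x..lam, (deriv f t - h' t) := by
      rw [hsub]; ring
    rw [e]
    calc |f lam - h lam - ∫ t in x..lam, (deriv f t - h' t)|
        ≤ |f lam - h lam| + |∫ t in x..lam, (deriv f t - h' t)| := abs_sub _ _
      _ ≤ (|f lam| + |h lam|) + η / 3 := add_le_add (abs_sub _ _) hI
      _ ≤ η := by linarith
  -- `[0, λ]`
  have key' : ∀ x ∈ Icc 0 lam, |f x - h x| ≤ η := by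
    intro x hx
    rcases lt_or_eq_of_le hx.2 with hxl | hxl
    · exact key x ⟨hx.1, hxl⟩
    · rw [hxl]
      calc |f lam - h lam| ≤ |f lam| + |h lam| := abs_sub _ _
        _ ≤ η := by linarith
  intro x hx
  rcases le_or_gt 0 x with hx0 | hx0
  · exact key' x ⟨hx0, hx.2⟩
  · have := key' (-x) ⟨by linarith, by linarith [hx.1]⟩
    rw [hf.even x, heven x] at this
    exact this

/-! ### Step 2: the eigenvalue bound `χ_n(λ) = μλ² + O(1)` -/

/-- **Eigenvalue asymptotics from sup-norm closeness**: if `max_{[−λ,λ]}|h_{n,λ} − g| → 0`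
uniformly, where `g″ = (4π²x² − μ)g`, `g′(0) = 0`, `g` bounded and integrable with `∫_0^∞ g² > 0`
and `(x²g′)′ ∈ L¹`, then `|χ_n(λ) − μλ²| ≤ D` for `λ` large (Green's identity
`(χ − λ²μ)∫_0^λ fg = ∫_0^λ f(x²g′)′` with `∫_0^λ fg ≥ ¼∫_0^∞ g²`).  The variant of
`eigen_sub_le_of_supLimit` without the factor `λ` in the hypothesis.
[cite: ConnesConsaniMoscovici2025, Lemma 7.2] -/
theorem eigen_sub_le_of_supClose {n : ℕ} {g g' : ℝ → ℝ} {μ : ℝ} (hg : ∀ x, HasDerivAt g (g' x) x)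
    (hg' : ∀ x, HasDerivAt g' ((4 * π ^ 2 * x ^ 2 - μ) * g x) x) (hg'0 : g' 0 = 0)
    {G : ℝ} (hG : ∀ x, |g x| ≤ G) (Ig : Integrable g)
    (IQ : IntegrableOn (fun x ↦ |2 * x * g' x + x ^ 2 * ((4 * π ^ 2 * x ^ 2 - μ) * g x)|) (Ioi 0))
    (hP : 0 < ∫ x in Ioi 0, g x ^ 2)
    (hS : ∀ η : ℝ, 0 < η → ∃ Λ : ℝ, ∀ lam : ℝ, Λ ≤ lam → ∀ f : ℝ → ℝ,
      IsProlateFunction lam n f → ∀ x ∈ Icc (-lam) lam, |f x - g x| ≤ η) :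
    ∃ D Λ : ℝ, 0 ≤ D ∧ ∀ lam : ℝ, Λ ≤ lam → ∀ (f : ℝ → ℝ) (χ : ℝ), IsProlateFunction lam n f →
      (∀ x ∈ Ioo (-lam) lam, -(deriv (fun y ↦ (lam ^ 2 - y ^ 2) * deriv f y) x)
          + (2 * π * lam * x) ^ 2 * f x = χ * f x) → |χ - lam ^ 2 * μ| ≤ D := by
  have hgc : Continuous g := continuous_iff_continuousAt.2 fun x ↦ (hg x).continuousAt
  have hg'c : Continuous g' := continuous_iff_continuousAt.2 fun x ↦ (hg' x).continuousAt
  have hG0 : 0 ≤ G := (abs_nonneg _).trans (hG 0)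
  set q : ℝ → ℝ := fun x ↦ 2 * x * g' x + x ^ 2 * ((4 * π ^ 2 * x ^ 2 - μ) * g x) with hq
  have hqc : Continuous q := by simp only [hq]; fun_prop
  set P : ℝ := ∫ x in Ioi 0, g x ^ 2 with hPdef
  set Q : ℝ := ∫ x in Ioi 0, |q x| with hQdef
  set N : ℝ := ∫ x in Ioi 0, |g x| with hNdef
  have hQ0 : 0 ≤ Q := setIntegral_nonneg measurableSet_Ioi fun x _ ↦ abs_nonneg _
  have hN0 : 0 ≤ N := setIntegral_nonneg measurableSet_Ioi fun x _ ↦ abs_nonneg _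
  have Ig2 : Integrable (fun x ↦ g x ^ 2) := by
    refine (Ig.abs.const_mul G).mono' (hgc.pow 2).aestronglyMeasurable (Eventually.of_forall fun x ↦ ?_)
    rw [Real.norm_eq_abs, abs_of_nonneg (sq_nonneg _), sq, ← abs_mul_abs_self]
    exact mul_le_mul_of_nonneg_right (hG x) (abs_nonneg _)
  have tP : Tendsto (fun lam : ℝ ↦ ∫ x in (0 : ℝ)..lam, g x ^ 2) atTop (𝓝 P) :=
    intervalIntegral_tendsto_integral_Ioi 0 Ig2.integrableOn tendsto_id
  have e1 : ∀ᶠ lam : ℝ in atTop, P / 2 ≤ ∫ x in (0 : ℝ)..lam, g x ^ 2 :=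
    (tP.eventually (Ioi_mem_nhds (by linarith : P / 2 < P))).mono fun lam h ↦ le_of_lt h
  set δ : ℝ := min 1 (P / (4 * (N + 1))) with hδdef
  have hδpos : 0 < δ := lt_min one_pos (by positivity)
  have hδ0 : 0 ≤ δ := hδpos.le
  have hδ1 : δ ≤ 1 := min_le_left _ _
  have hδN : δ * N ≤ P / 4 := by
    have h1 : δ * N ≤ P / (4 * (N + 1)) * N := mul_le_mul_of_nonneg_right (min_le_right _ _) hN0
    have h2 : P / (4 * (N + 1)) * N ≤ P / 4 := by
      rw [div_mul_eq_mul_div, div_le_div_iff₀ (by positivity) (by positivity)]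
      nlinarith
    exact h1.trans h2
  obtain ⟨Λs, hΛS⟩ := hS δ hδpos
  obtain ⟨Λ, hΛ⟩ := Filter.eventually_atTop.1 (e1.and (eventually_ge_atTop (max Λs 1)))
  refine ⟨4 * ((G + 1) * Q) / P, Λ, by positivity, fun lam hlam f χ hf hχ ↦ ?_⟩
  obtain ⟨hP2, hΛs1⟩ := hΛ lam hlam
  have hΛs : Λs ≤ lam := (le_max_left _ _).trans hΛs1
  have hlam0 := hf.lam_pos
  have hδ : ∀ x ∈ Icc (-lam) lam, |f x - g x| ≤ δ := fun x hx ↦ hΛS lam hΛs f hf x hx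
  have hcf : ContinuousOn f (Icc 0 lam) :=
    hf.contDiffOn.continuousOn.mono (Icc_subset_Icc (by linarith) le_rfl)
  have hu : uIcc 0 lam = Icc 0 lam := uIcc_of_le hlam0.le
  have ifg : IntervalIntegrable (fun x ↦ f x * g x) volume 0 lam :=
    ((hcf.mul hgc.continuousOn).mono hu.le).intervalIntegrable
  have ifq : IntervalIntegrable (fun x ↦ f x * q x) volume 0 lam :=
    ((hcf.mul hqc.continuousOn).mono hu.le).intervalIntegrable
  have hgreen := hf.eigen_sub_mul_integral_eq hχ hg hg' hg'0
  have hlow : P / 4 ≤ ∫ x in (0 : ℝ)..lam, f x * g x := by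
    have hpt : ∀ x ∈ Icc 0 lam, g x ^ 2 - δ * |g x| ≤ f x * g x := by
      intro x hx
      have h1 : |(f x - g x) * g x| ≤ δ * |g x| := by
        rw [abs_mul]; exact mul_le_mul_of_nonneg_right (hδ x ⟨by linarith [hx.1], hx.2⟩) (abs_nonneg _)
      have h2 := neg_abs_le ((f x - g x) * g x)
      nlinarith
    have ig2 : IntervalIntegrable (fun x ↦ g x ^ 2) volume 0 lam := (hgc.pow 2).intervalIntegrable _ _
    have igd : IntervalIntegrable (fun x ↦ δ * |g x|) volume 0 lam :=
      (continuous_const.mul hgc.abs).intervalIntegrable _ _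
    have hmono := intervalIntegral.integral_mono_on hlam0.le (ig2.sub igd) ifg hpt
    rw [intervalIntegral.integral_sub ig2 igd, intervalIntegral.integral_const_mul] at hmono
    have hN : (∫ x in (0 : ℝ)..lam, |g x|) ≤ N := by
      rw [intervalIntegral.integral_of_le hlam0.le]
      exact setIntegral_mono_set Ig.abs.integrableOn
        (Eventually.of_forall fun x ↦ abs_nonneg _) (Eventually.of_forall Ioc_subset_Ioi_self)
    nlinarith
  have hup : |∫ x in (0 : ℝ)..lam, f x * q x| ≤ (G + 1) * Q := by
    have hpt : ∀ x ∈ Icc 0 lam, |f x * q x| ≤ (G + 1) * |q x| := by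
      intro x hx
      rw [abs_mul]
      refine mul_le_mul_of_nonneg_right ?_ (abs_nonneg _)
      have := hδ x ⟨by linarith [hx.1], hx.2⟩
      have := hG x
      have := abs_sub_abs_le_abs_sub (f x) (g x)
      linarith
    calc |∫ x in (0 : ℝ)..lam, f x * q x| ≤ ∫ x in (0 : ℝ)..lam, |f x * q x| :=
          intervalIntegral.abs_integral_le_integral_abs hlam0.le
      _ ≤ ∫ x in (0 : ℝ)..lam, (G + 1) * |q x| :=
          intervalIntegral.integral_mono_on hlam0.le ifq.abs
            ((continuous_const.mul hqc.abs).intervalIntegrable _ _) hpt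
      _ = (G + 1) * ∫ x in (0 : ℝ)..lam, |q x| := intervalIntegral.integral_const_mul _ _
      _ ≤ (G + 1) * Q := by
          refine mul_le_mul_of_nonneg_left ?_ (by positivity)
          rw [intervalIntegral.integral_of_le hlam0.le]
          exact setIntegral_mono_set IQ (Eventually.of_forall fun x ↦ abs_nonneg _)
            (Eventually.of_forall Ioc_subset_Ioi_self)
  have hfg0 : 0 < ∫ x in (0 : ℝ)..lam, f x * g x := lt_of_lt_of_le (by positivity) hlow
  have key : |χ - lam ^ 2 * μ| * (P / 4) ≤ (G + 1) * Q := by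
    calc |χ - lam ^ 2 * μ| * (P / 4) ≤ |χ - lam ^ 2 * μ| * ∫ x in (0 : ℝ)..lam, f x * g x :=
          mul_le_mul_of_nonneg_left hlow (abs_nonneg _)
      _ = |(χ - lam ^ 2 * μ) * ∫ x in (0 : ℝ)..lam, f x * g x| := by
          rw [abs_mul, abs_of_pos hfg0]
      _ = |∫ x in (0 : ℝ)..lam, f x * q x| := by rw [hgreen]
      _ ≤ (G + 1) * Q := hup
  rw [le_div_iff₀ hP]
  linarith

/-! ### Step 4 ingredients: the end point value and the forbidden region -/

namespace IsProlateFunction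

variable {lam : ℝ} {n : ℕ} {f : ℝ → ℝ}

/-- **End-point value past the turning point**: if `0 ≤ X`, `2X + 2 ≤ λ` and `χ ≤ (2πλX)²`, then
`λ³|f(λ)| ≤ |f′(X)|`: integrate `((2πλt)² − χ)|f(t)| ≥ 4π²λ²(t − X)²|f(λ)|` over `[X, λ − 1]`
against `∫_X^x((2πλt)² − χ)|f| ≤ (λ² − X²)|f′(X)|` (`integral_coef_mul_abs_le_of_turning`).
[folklore] -/
theorem cube_mul_abs_apply_lam_le (hf : IsProlateFunction lam n f) {χ : ℝ}
    (hχ : ∀ x ∈ Ioo (-lam) lam,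
      -(deriv (fun y ↦ (lam ^ 2 - y ^ 2) * deriv f y) x) + (2 * π * lam * x) ^ 2 * f x = χ * f x)
    {X : ℝ} (hX : 0 ≤ X) (hl : 2 * X + 2 ≤ lam) (hχX : χ ≤ (2 * π * lam * X) ^ 2) :
    lam ^ 3 * |f lam| ≤ |deriv f X| := by
  have hlam := hf.lam_pos
  obtain ⟨x, hxdef⟩ : ∃ x : ℝ, x = lam - 1 := ⟨_, rfl⟩
  have hXx : X ≤ x := by rw [hxdef]; linarith
  have hxl : x < lam := by rw [hxdef]; linarith
  have hXI : X ∈ Ico X lam := ⟨le_rfl, by linarith⟩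
  have hxI : x ∈ Ico X lam := ⟨hXx, hxl⟩
  have hup := hf.integral_coef_mul_abs_le_of_turning hχ hX hχX hXI hxI
  have hpt : ∀ t ∈ Icc X x, 4 * π ^ 2 * lam ^ 2 * |f lam| * (t - X) ^ 2
      ≤ ((2 * π * lam * t) ^ 2 - χ) * |f t| := by
    intro t ht
    have htI : t ∈ Ico X lam := ⟨ht.1, lt_of_le_of_lt ht.2 hxl⟩
    have h1 : |f lam| ≤ |f t| := hf.abs_apply_lam_le_of_turning hχ hX hχX htI
    have h2 : 4 * π ^ 2 * lam ^ 2 * (t - X) ^ 2 ≤ (2 * π * lam * t) ^ 2 - χ := by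
      have e : (2 * π * lam * t) ^ 2 - (2 * π * lam * X) ^ 2
          = 4 * π ^ 2 * lam ^ 2 * (t ^ 2 - X ^ 2) := by ring
      have h3 : (t - X) ^ 2 ≤ t ^ 2 - X ^ 2 := by nlinarith [ht.1]
      have h4 : 0 ≤ 4 * π ^ 2 * lam ^ 2 := by positivity
      nlinarith [mul_le_mul_of_nonneg_left h3 h4]
    have h5 : 0 ≤ 4 * π ^ 2 * lam ^ 2 * (t - X) ^ 2 := by positivity
    calc 4 * π ^ 2 * lam ^ 2 * |f lam| * (t - X) ^ 2
        = (4 * π ^ 2 * lam ^ 2 * (t - X) ^ 2) * |f lam| := by ring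
      _ ≤ ((2 * π * lam * t) ^ 2 - χ) * |f t| := mul_le_mul h2 h1 (abs_nonneg _) (h5.trans h2)
  have hcont : ContinuousOn (fun t ↦ ((2 * π * lam * t) ^ 2 - χ) * |f t|) (Icc X x) :=
    (by fun_prop : Continuous fun t : ℝ ↦ (2 * π * lam * t) ^ 2 - χ).continuousOn.mul
      ((hf.contDiffOn.continuousOn.abs).mono (Icc_subset_Icc (by linarith) hxl.le))
  have hi1 : IntervalIntegrable (fun t ↦ ((2 * π * lam * t) ^ 2 - χ) * |f t|) volume X x :=
    (hcont.mono (by rw [uIcc_of_le hXx])).intervalIntegrable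
  have hi2 : IntervalIntegrable (fun t ↦ 4 * π ^ 2 * lam ^ 2 * |f lam| * (t - X) ^ 2) volume X x :=
    (by fun_prop : Continuous fun t : ℝ ↦ 4 * π ^ 2 * lam ^ 2 * |f lam| * (t - X) ^ 2).intervalIntegrable _ _
  have hmono := intervalIntegral.integral_mono_on hXx hi2 hi1 hpt
  have hI3 : ∫ t in X..x, 4 * π ^ 2 * lam ^ 2 * |f lam| * (t - X) ^ 2
      = 4 * π ^ 2 * lam ^ 2 * |f lam| * ((x - X) ^ 3 / 3) := by
    rw [intervalIntegral.integral_const_mul]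
    congr 1
    have hderiv : ∀ t ∈ uIcc X x, HasDerivAt (fun t ↦ (t - X) ^ 3 / 3) ((t - X) ^ 2) t := by
      intro t _
      have h := (((hasDerivAt_id t).sub_const X).pow 3).div_const 3
      refine h.congr_deriv ?_
      simp only [id]
      ring
    rw [intervalIntegral.integral_eq_sub_of_hasDerivAt hderiv
      ((by fun_prop : Continuous fun t : ℝ ↦ (t - X) ^ 2).intervalIntegrable _ _)]
    simp
  have hxX : lam / 2 ≤ x - X := by rw [hxdef]; linarith
  have hcube : lam ^ 3 / 8 ≤ (x - X) ^ 3 := by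
    have := pow_le_pow_left₀ (by linarith : 0 ≤ lam / 2) hxX 3
    calc lam ^ 3 / 8 = (lam / 2) ^ 3 := by ring
      _ ≤ (x - X) ^ 3 := this
  rw [hI3] at hmono
  have h6 : (lam ^ 2 - X ^ 2) * |deriv f X| ≤ lam ^ 2 * |deriv f X| :=
    mul_le_mul_of_nonneg_right (by nlinarith) (abs_nonneg _)
  have hπ : 9 ≤ π ^ 2 := by nlinarith [Real.pi_gt_three]
  have h7 : 4 * π ^ 2 * lam ^ 2 * |f lam| * (lam ^ 3 / 8 / 3) ≤ lam ^ 2 * |deriv f X| := by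
    have := mul_le_mul_of_nonneg_left
      (div_le_div_of_nonneg_right hcube (by norm_num : (0 : ℝ) ≤ 3))
      (by positivity : 0 ≤ 4 * π ^ 2 * lam ^ 2 * |f lam|)
    linarith [hmono.trans (hup.trans h6)]
  have hl2 : 0 < lam ^ 2 := by positivity
  have h8 : π ^ 2 / 6 * (lam ^ 3 * |f lam|) ≤ |deriv f X| := by
    have e : 4 * π ^ 2 * lam ^ 2 * |f lam| * (lam ^ 3 / 8 / 3)
        = lam ^ 2 * (π ^ 2 / 6 * (lam ^ 3 * |f lam|)) := by ring
    rw [e] at h7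
    exact le_of_mul_le_mul_left h7 hl2
  have h9 : lam ^ 3 * |f lam| ≤ π ^ 2 / 6 * (lam ^ 3 * |f lam|) := by
    have : 0 ≤ lam ^ 3 * |f lam| := by positivity
    nlinarith
  exact h9.trans h8

/-- **The forbidden region** `[X, λ]`.  For `e = f − c·h` with `h″ = (4π²x² − μ)h`,
`((λ²−x²)e′)′ = ((2πλx)² − χ)e + c((λ²μ − χ)h + (x²h′)′)`; so if `(2πλx)² − χ ≥ K > 0` and
`|c((λ²μ − χ)h + (x²h′)′)| ≤ W` on `(X, λ)`, then `|e| ≤ max(|e(X)|, |e(λ)|, W/K)` on `[X, λ]`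
(`abs_le_max_of_sturm`). [folklore] -/
theorem abs_sub_mul_le_max (hf : IsProlateFunction lam n f) {χ : ℝ}
    (hχ : ∀ x ∈ Ioo (-lam) lam,
      -(deriv (fun y ↦ (lam ^ 2 - y ^ 2) * deriv f y) x) + (2 * π * lam * x) ^ 2 * f x = χ * f x)
    {h h' : ℝ → ℝ} {μ : ℝ} (hh : ∀ x, HasDerivAt h (h' x) x)
    (hh' : ∀ x, HasDerivAt h' ((4 * π ^ 2 * x ^ 2 - μ) * h x) x) {c X K W : ℝ} (hX : 0 ≤ X)
    (hXl : X ≤ lam) (hK : 0 < K) (hW : 0 ≤ W)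
    (hV : ∀ x ∈ Ioo X lam, K ≤ (2 * π * lam * x) ^ 2 - χ)
    (hρ : ∀ x ∈ Ioo X lam,
      |c * ((lam ^ 2 * μ - χ) * h x + (2 * x * h' x + x ^ 2 * ((4 * π ^ 2 * x ^ 2 - μ) * h x)))|
        ≤ W) :
    ∀ x ∈ Icc X lam, |f x - c * h x|
      ≤ max (max |f X - c * h X| |f lam - c * h lam|) (W / K) := by
  have hlam := hf.lam_pos
  have hhc : Continuous h := continuous_iff_continuousAt.2 fun y ↦ (hh y).continuousAt
  have hec : ContinuousOn (fun x ↦ f x - c * h x) (Icc X lam) :=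
    (hf.contDiffOn.continuousOn.mono (Icc_subset_Icc (by linarith) le_rfl)).sub
      (continuousOn_const.mul hhc.continuousOn)
  have hed : ∀ x ∈ Ioo X lam, HasDerivAt (fun x ↦ f x - c * h x) (deriv f x - c * h' x) x :=
    fun x hx ↦ ((hf.differentiableAt ⟨by linarith [hx.1], hx.2⟩).hasDerivAt).sub
      ((hh x).const_mul c)
  have hPp : ∀ x ∈ Ioo X lam, (lam ^ 2 - x ^ 2) * deriv f x - c * ((lam ^ 2 - x ^ 2) * h' x)
      = (lam ^ 2 - x ^ 2) * (deriv f x - c * h' x) := fun x _ ↦ by ring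
  have hp : ∀ x ∈ Ioo X lam, 0 < lam ^ 2 - x ^ 2 := fun x hx ↦ by nlinarith [hx.1, hx.2]
  have hPd : ∀ x ∈ Ioo X lam, HasDerivAt
      (fun y ↦ (lam ^ 2 - y ^ 2) * deriv f y - c * ((lam ^ 2 - y ^ 2) * h' y))
      (((2 * π * lam * x) ^ 2 - χ) * (f x - c * h x)
        + c * ((lam ^ 2 * μ - χ) * h x
          + (2 * x * h' x + x ^ 2 * ((4 * π ^ 2 * x ^ 2 - μ) * h x)))) x := by
    intro x hx
    have hxI : x ∈ Ioo (-lam) lam := ⟨by linarith [hx.1], hx.2⟩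
    have h1 := hf.hasDerivAt_sqMulDeriv hχ hxI
    have hp2 : HasDerivAt (fun y : ℝ ↦ lam ^ 2 - y ^ 2) (-(2 * x)) x := by
      simpa using (hasDerivAt_pow 2 x).const_sub (lam ^ 2)
    have h2 := hp2.mul (hh' x)
    have h3 := h1.sub (h2.const_mul c)
    refine h3.congr_deriv ?_
    ring
  exact abs_le_max_of_sturm (e := fun x ↦ f x - c * h x) (e' := fun x ↦ deriv f x - c * h' x)
    (P := fun y ↦ (lam ^ 2 - y ^ 2) * deriv f y - c * ((lam ^ 2 - y ^ 2) * h' y))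
    (p := fun x ↦ lam ^ 2 - x ^ 2) (V := fun x ↦ (2 * π * lam * x) ^ 2 - χ)
    (ρ := fun x ↦ c * ((lam ^ 2 * μ - χ) * h x
      + (2 * x * h' x + x ^ 2 * ((4 * π ^ 2 * x ^ 2 - μ) * h x))))
    hXl hec hed hPp hp hPd hV hρ hK hW

end IsProlateFunction

/-! ### Step 5 ingredients: the `h²` tail and the scale -/

/-- Tail of `∫h²` under `x²|h| ≤ B`: `½ − B²/λ² ≤ ∫_0^λ h²` for `λ ≥ 1` when `∫_0^X h² → ½`
(`h² ≤ B²λ^{-2}t^{-2}` on `[λ, ∞)`). [folklore] -/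
theorem half_sub_le_integral_sq {h : ℝ → ℝ} (hhc : Continuous h) {B : ℝ}
    (hB : ∀ x, x ^ 2 * |h x| ≤ B)
    (hI : Tendsto (fun X ↦ ∫ x in (0 : ℝ)..X, h x ^ 2) atTop (𝓝 (1 / 2))) {lam : ℝ}
    (hlam : 1 ≤ lam) : 1 / 2 - B ^ 2 / lam ^ 2 ≤ ∫ x in (0 : ℝ)..lam, h x ^ 2 := by
  have hlam0 : 0 < lam := by linarith
  have i2 : ∀ a b : ℝ, IntervalIntegrable (fun x ↦ h x ^ 2) volume a b := fun a b ↦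
    (hhc.pow 2).intervalIntegrable _ _
  have hev : ∀ᶠ Y in atTop, (∫ x in (0 : ℝ)..Y, h x ^ 2)
      ≤ (∫ x in (0 : ℝ)..lam, h x ^ 2) + B ^ 2 / lam ^ 2 := by
    filter_upwards [eventually_ge_atTop lam] with Y hY
    have hsplit : (∫ x in (0 : ℝ)..Y, h x ^ 2)
        = (∫ x in (0 : ℝ)..lam, h x ^ 2) + ∫ x in lam..Y, h x ^ 2 :=
      (intervalIntegral.integral_add_adjacent_intervals (i2 0 lam) (i2 lam Y)).symm
    have hpt : ∀ t ∈ Icc lam Y, h t ^ 2 ≤ B ^ 2 / lam ^ 2 * (t ^ 2)⁻¹ := by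
      intro t ht
      have ht0 : 0 < t := by linarith [ht.1]
      have h1 := hB t
      have h2 : 0 ≤ t ^ 2 * |h t| := by positivity
      have h3 : (t ^ 2 * |h t|) ^ 2 ≤ B ^ 2 := pow_le_pow_left₀ h2 h1 2
      have h4 : lam ^ 2 ≤ t ^ 2 := pow_le_pow_left₀ hlam0.le ht.1 2
      have ht2 : 0 < t ^ 2 := by positivity
      rw [show B ^ 2 / lam ^ 2 * (t ^ 2)⁻¹ = B ^ 2 / (lam ^ 2 * t ^ 2) by field_simp,
        le_div_iff₀ (by positivity)]
      calc h t ^ 2 * (lam ^ 2 * t ^ 2) ≤ h t ^ 2 * (t ^ 2 * t ^ 2) :=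
            mul_le_mul_of_nonneg_left (mul_le_mul_of_nonneg_right h4 ht2.le) (sq_nonneg _)
        _ = (t ^ 2 * |h t|) ^ 2 := by rw [mul_pow, sq_abs]; ring
        _ ≤ B ^ 2 := h3
    have hne : ∀ t ∈ uIcc lam Y, t ≠ 0 := fun t ht ↦ by
      rw [uIcc_of_le hY] at ht; exact ne_of_gt (by linarith [ht.1])
    have hderiv : ∀ t ∈ uIcc lam Y, HasDerivAt (fun t : ℝ ↦ -t⁻¹) ((t ^ 2)⁻¹) t := fun t ht ↦ by
      have := (hasDerivAt_inv (hne t ht)).neg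
      refine this.congr_deriv ?_
      ring
    have hci : IntervalIntegrable (fun t : ℝ ↦ (t ^ 2)⁻¹) volume lam Y :=
      ((continuousOn_pow 2).inv₀ fun t ht ↦ pow_ne_zero 2 (hne t ht)).intervalIntegrable
    have hint : ∫ t in lam..Y, (t ^ 2)⁻¹ = -Y⁻¹ - -lam⁻¹ :=
      intervalIntegral.integral_eq_sub_of_hasDerivAt hderiv hci
    have hinv : ∫ t in lam..Y, (t ^ 2)⁻¹ ≤ 1 := by
      rw [hint]
      have : 0 < Y⁻¹ := inv_pos.2 (by linarith)
      have : lam⁻¹ ≤ 1 := inv_le_one_of_one_le₀ hlam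
      linarith
    have htail : ∫ x in lam..Y, h x ^ 2 ≤ B ^ 2 / lam ^ 2 := by
      calc ∫ x in lam..Y, h x ^ 2 ≤ ∫ x in lam..Y, B ^ 2 / lam ^ 2 * (x ^ 2)⁻¹ :=
            intervalIntegral.integral_mono_on hY (i2 lam Y) (hci.const_mul _) hpt
        _ = B ^ 2 / lam ^ 2 * ∫ x in lam..Y, (x ^ 2)⁻¹ := intervalIntegral.integral_const_mul _ _
        _ ≤ B ^ 2 / lam ^ 2 * 1 := mul_le_mul_of_nonneg_left hinv (by positivity)
        _ = B ^ 2 / lam ^ 2 := mul_one _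
    rw [hsplit]
    linarith
  have := le_of_tendsto hI hev
  linarith

/-- The scale: `|½ − c²I| ≤ a`, `|I − ½| ≤ b`, `¼ ≤ I`, `0 ≤ c` give `|c − 1| ≤ 4(a + b)`
(`|c − 1| ≤ |c² − 1| = |c²I − I|/I`). [folklore] -/
theorem abs_sub_one_le_of_sq {c I a b : ℝ} (hc : 0 ≤ c) (hI : 1 / 4 ≤ I)
    (h1 : |1 / 2 - c ^ 2 * I| ≤ a) (h2 : |I - 1 / 2| ≤ b) : |c - 1| ≤ 4 * (a + b) := by
  have hI0 : 0 ≤ I := by linarith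
  have h3 : |c ^ 2 * I - I| ≤ a + b := by
    calc |c ^ 2 * I - I| = |-(1 / 2 - c ^ 2 * I) + -(I - 1 / 2)| := by congr 1; ring
      _ ≤ |-(1 / 2 - c ^ 2 * I)| + |-(I - 1 / 2)| := abs_add_le _ _
      _ ≤ a + b := by rw [abs_neg, abs_neg]; exact add_le_add h1 h2
  have h4 : |c ^ 2 - 1| * I ≤ a + b := by
    calc |c ^ 2 - 1| * I = |c ^ 2 - 1| * |I| := by rw [abs_of_nonneg hI0]
      _ = |(c ^ 2 - 1) * I| := (abs_mul _ _).symm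
      _ = |c ^ 2 * I - I| := by congr 1; ring
      _ ≤ a + b := h3
  have h5 : |c ^ 2 - 1| ≤ 4 * (a + b) := by
    have : |c ^ 2 - 1| * (1 / 4) ≤ |c ^ 2 - 1| * I := mul_le_mul_of_nonneg_left hI (abs_nonneg _)
    linarith
  have h6 : |c - 1| ≤ |c ^ 2 - 1| := by
    have e : c ^ 2 - 1 = (c - 1) * (c + 1) := by ring
    rw [e, abs_mul, abs_of_nonneg (by linarith : 0 ≤ c + 1)]
    have : |c - 1| * 1 ≤ |c - 1| * (c + 1) := mul_le_mul_of_nonneg_left (by linarith) (abs_nonneg _)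
    linarith
  exact h6.trans h5

/-! ### CCM25 Lemma 7.2(i) for an abstract Hermite datum -/

/-- **CCM25 Lemma 7.2(i), abstract form.**  Let `h` solve `h″ = (4π²x² − μ)h` (`μ ≥ 1`) with
`h(0) > 0`, `h′(0) = 0`, `h` even, bounded, integrable, `∫_0^∞h² > 0`, `(x²h′)′` bounded and
integrable on `[0, ∞)`, `x²|h| ≤ B`, `∫_0^Xh² → ½`, and suppose the uniform `W^{1,1}` limits of
`IsProlateFunction.uniform_limits` hold for the prolate functions with `n` zeros.  Then
`max_{[−λ,λ]}|h_{n,λ} − h| ≤ Cλ^{-2}` for `λ ≥ Λ` (`prolateSupNormRate n h`): window + maximum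
principle on the forbidden region + normalisation, see the module docstring.
[cite: ConnesConsaniMoscovici2025, Lemma 7.2; SlepianPollak1961, §III] -/
theorem prolateSupNormRate_of_uniform_limits {n : ℕ} {μ : ℝ} (hμ : 1 ≤ μ) {h h' : ℝ → ℝ}
    (hh : ∀ x, HasDerivAt h (h' x) x)
    (hh' : ∀ x, HasDerivAt h' ((4 * π ^ 2 * x ^ 2 - μ) * h x) x)
    (hh0 : 0 < h 0) (hh'0 : h' 0 = 0) (heven : ∀ x, h (-x) = h x) {H : ℝ} (hH : ∀ x, |h x| ≤ H)
    (Ih : Integrable h) (hPos : 0 < ∫ x in Ioi 0, h x ^ 2)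
    (IQ : IntegrableOn (fun x ↦ |2 * x * h' x + x ^ 2 * ((4 * π ^ 2 * x ^ 2 - μ) * h x)|) (Ioi 0))
    {Q₀ : ℝ} (hQ : ∀ x, 0 ≤ x → |2 * x * h' x + x ^ 2 * ((4 * π ^ 2 * x ^ 2 - μ) * h x)| ≤ Q₀)
    {B : ℝ} (hB : ∀ x, x ^ 2 * |h x| ≤ B)
    (hI : Tendsto (fun X ↦ ∫ x in (0 : ℝ)..X, h x ^ 2) atTop (𝓝 (1 / 2)))
    (U : ∀ ε : ℝ, 0 < ε → ∃ Λ : ℝ, ∀ lam : ℝ, Λ ≤ lam → ∀ f : ℝ → ℝ, IsProlateFunction lam n f →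
      lam * |f lam| ≤ ε ∧ (∫ x in (0 : ℝ)..lam, |f x - h x|) ≤ ε ∧
      (∫ x in (0 : ℝ)..lam, |deriv f x - h' x| * (1 + x)) ≤ ε) :
    prolateSupNormRate n h := by
  have hhc : Continuous h := continuous_iff_continuousAt.2 fun y ↦ (hh y).continuousAt
  have hh'c : Continuous h' := continuous_iff_continuousAt.2 fun y ↦ (hh' y).continuousAt
  have hH0 : 0 ≤ H := (abs_nonneg _).trans (hH 0)
  have hB0 : 0 ≤ B := by simpa using hB 0
  have hQ0 : 0 ≤ Q₀ := (abs_nonneg _).trans (hQ 0 le_rfl)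
  obtain ⟨N, hNdef⟩ : ∃ N : ℝ, N = ∫ x in Ioi 0, |h x| := ⟨_, rfl⟩
  have hN0 : 0 ≤ N := by rw [hNdef]; exact setIntegral_nonneg measurableSet_Ioi fun x _ ↦ abs_nonneg _
  -- Steps 1 and 2
  have hS := IsProlateFunction.supClose_of_uniform_limits hh hh'c heven hB U
  obtain ⟨D, ΛB, hD0, hD⟩ := eigen_sub_le_of_supClose hh hh' hh'0 hH Ih IQ hPos hS
  obtain ⟨ΛA, hA⟩ := hS 1 one_pos
  obtain ⟨ΛU, hU1⟩ := U 1 one_pos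
  -- the window `X` and the constants
  obtain ⟨X, hXdef⟩ : ∃ X : ℝ, X = μ + D + 2 := ⟨_, rfl⟩
  have hX2 : 2 ≤ X := by rw [hXdef]; linarith
  have hX0 : 0 ≤ X := by linarith
  have hgap : μ + D + 1 ≤ 4 * π ^ 2 * X ^ 2 := by
    have hπ : 9 ≤ π ^ 2 := by nlinarith [Real.pi_gt_three]
    have h1 : X ≤ X ^ 2 := by rw [sq]; exact le_mul_of_one_le_left hX0 (by linarith)
    have h2 : X ^ 2 ≤ 4 * π ^ 2 * X ^ 2 := le_mul_of_one_le_left (sq_nonneg X) (by linarith)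
    have h3 : μ + D + 1 ≤ X := by rw [hXdef]; linarith
    linarith
  obtain ⟨E, hEdef⟩ : ∃ E : ℝ, E = Real.exp (8 * (4 * π ^ 2 * X ^ 2 + μ + 2) * X) := ⟨_, rfl⟩
  have hE0 : 0 < E := by rw [hEdef]; exact Real.exp_pos _
  obtain ⟨Cx, hCxdef⟩ : ∃ Cx : ℝ, Cx = 2 * X + 4 * π ^ 2 * X ^ 4 + μ * X ^ 2 := ⟨_, rfl⟩
  have hCx0 : 0 ≤ Cx := by rw [hCxdef]; positivity
  obtain ⟨cM, hcMdef⟩ : ∃ cM : ℝ, cM = (h 0 + 1) / h 0 := ⟨_, rfl⟩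
  have hcM0 : 0 ≤ cM := by rw [hcMdef]; positivity
  obtain ⟨A₁, hA₁def⟩ : ∃ A₁ : ℝ, A₁ = (h 0 + 1) * (2 * E * (D + Cx)) := ⟨_, rfl⟩
  have hA₁0 : 0 ≤ A₁ := by rw [hA₁def]; positivity
  obtain ⟨A₂, hA₂def⟩ : ∃ A₂ : ℝ, A₂ = cM * |h' X| + A₁ := ⟨_, rfl⟩
  have hA₂0 : 0 ≤ A₂ := by rw [hA₂def]; positivity
  obtain ⟨W, hWdef⟩ : ∃ W : ℝ, W = cM * (D * H + Q₀) := ⟨_, rfl⟩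
  have hW0 : 0 ≤ W := by rw [hWdef]; positivity
  have hcMB : 0 ≤ cM * B := mul_nonneg hcM0 hB0
  obtain ⟨T, hTdef⟩ : ∃ T : ℝ, T = A₁ + (A₂ + cM * B) + W := ⟨_, rfl⟩
  have hT0 : 0 ≤ T := by rw [hTdef]; positivity
  obtain ⟨T₂, hT₂def⟩ : ∃ T₂ : ℝ, T₂ = T * (1 + N + cM * N) := ⟨_, rfl⟩
  have hT₂0 : 0 ≤ T₂ := by rw [hT₂def]; positivity
  refine ⟨T + 4 * (T₂ + B ^ 2) * H,
    max (max ΛA (max ΛB ΛU)) (max (2 * X + 2) (D + 4 * B ^ 2 + 1)), fun lam hlam f hf ↦ ?_⟩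
  have hlA : ΛA ≤ lam := le_trans (le_trans (le_max_left _ _) (le_max_left _ _)) hlam
  have hlB : ΛB ≤ lam :=
    le_trans (le_trans (le_trans (le_max_left _ _) (le_max_right _ _)) (le_max_left _ _)) hlam
  have hlU : ΛU ≤ lam :=
    le_trans (le_trans (le_trans (le_max_right _ _) (le_max_right _ _)) (le_max_left _ _)) hlam
  have hl2X : 2 * X + 2 ≤ lam := le_trans (le_trans (le_max_left _ _) (le_max_right _ _)) hlam
  have hlDB : D + 4 * B ^ 2 + 1 ≤ lam :=
    le_trans (le_trans (le_max_right _ _) (le_max_right _ _)) hlam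
  have hlam0 := hf.lam_pos
  have hlam1 : 1 ≤ lam := by linarith [sq_nonneg B]
  have hlsq : lam ≤ lam ^ 2 := le_self_pow₀ hlam1 two_ne_zero
  have hl2 : 0 < lam ^ 2 := by positivity
  have hDl : D ≤ lam ^ 2 := by linarith [sq_nonneg B]
  obtain ⟨χ, hχ⟩ := hf.eigen
  have hDχ : |χ - lam ^ 2 * μ| ≤ D := hD lam hlB f χ hf hχ
  have hχlo : lam ^ 2 * μ - D ≤ χ := by have := (abs_le.1 hDχ).1; linarith
  have hχhi : χ ≤ lam ^ 2 * μ + D := by have := (abs_le.1 hDχ).2; linarith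
  have hχ0 : 0 ≤ χ := by
    have : lam ^ 2 * 1 ≤ lam ^ 2 * μ := mul_le_mul_of_nonneg_left hμ hl2.le
    linarith
  have hχδ : |χ - μ * lam ^ 2| ≤ D / lam ^ 2 * lam ^ 2 := by
    rw [div_mul_cancel₀ _ hl2.ne', mul_comm μ]; exact hDχ
  have hδ0 : 0 ≤ D / lam ^ 2 := div_nonneg hD0 hl2.le
  have hδ1 : D / lam ^ 2 ≤ 1 := by rw [div_le_one hl2]; exact hDl
  -- the turning point is below `X`: `(2πλX)² − χ ≥ λ²`
  have hturn : lam ^ 2 ≤ (2 * π * lam * X) ^ 2 - χ := by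
    have e : (2 * π * lam * X) ^ 2 = (4 * π ^ 2 * X ^ 2) * lam ^ 2 := by ring
    have h1 : (μ + D + 1) * lam ^ 2 ≤ (4 * π ^ 2 * X ^ 2) * lam ^ 2 :=
      mul_le_mul_of_nonneg_right hgap hl2.le
    have h2 : D ≤ D * lam ^ 2 := le_mul_of_one_le_right hD0 (by linarith)
    rw [e]; linarith
  have hχX : χ ≤ (2 * π * lam * X) ^ 2 := by linarith
  -- the scale `c = f(0)/h(0)`
  have hf0 := hf.pos_zero
  obtain ⟨c, hcdef⟩ : ∃ c : ℝ, c = f 0 / h 0 := ⟨_, rfl⟩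
  have hc0 : 0 < c := by rw [hcdef]; exact div_pos hf0 hh0
  have hf01 : f 0 ≤ h 0 + 1 := by
    have := hA lam hlA f hf 0 ⟨by linarith, by linarith⟩
    have := (abs_le.1 this).2; linarith
  have hccM : c ≤ cM := by rw [hcdef, hcMdef]; exact div_le_div_of_nonneg_right hf01 hh0.le
  have hdivmono : ∀ {a b : ℝ}, a ≤ b → a / lam ^ 2 ≤ b / lam ^ 2 := fun hab ↦
    div_le_div_of_nonneg_right hab hl2.le
  -- Step 3: the window `[0, X]`
  have hwin : ∀ x ∈ Icc 0 X, |f x - c * h x| ≤ A₁ / lam ^ 2 ∧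
      |deriv f x - c * h' x| ≤ A₁ / lam ^ 2 := by
    intro x hx
    have hw := hf.window_compare hχ hX0 (by linarith : (0 : ℝ) ≤ μ) hδ0 hδ1 hl2X hχ0 hχδ hh hh'
      hh0 hh'0 hx
    rw [← hEdef, ← hCxdef, ← hcdef, ← add_div, ← mul_div_assoc, ← mul_div_assoc] at hw
    have hle : f 0 * (2 * E * (D + Cx)) / lam ^ 2 ≤ A₁ / lam ^ 2 := by
      rw [hA₁def]
      exact hdivmono (mul_le_mul_of_nonneg_right hf01 (by positivity))
    exact ⟨hw.1.trans hle, hw.2.trans hle⟩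
  -- Step 4: the end point value and the forbidden region `[X, λ]`
  have hend := hf.cube_mul_abs_apply_lam_le hχ hX0 hl2X hχX
  have hf'X : |deriv f X| ≤ A₂ := by
    have h1 := (hwin X ⟨hX0, le_rfl⟩).2
    have h2 : A₁ / lam ^ 2 ≤ A₁ := div_le_self hA₁0 (by linarith)
    have h3 : |c * h' X| ≤ cM * |h' X| := by
      rw [abs_mul, abs_of_pos hc0]; exact mul_le_mul_of_nonneg_right hccM (abs_nonneg _)
    have h4 := abs_sub_abs_le_abs_sub (deriv f X) (c * h' X)
    rw [hA₂def]
    linarith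
  have hflam : |f lam| ≤ A₂ / lam ^ 2 := by
    rw [le_div_iff₀ hl2]
    have h3 : lam ^ 2 ≤ lam ^ 3 := pow_le_pow_right₀ hlam1 (by norm_num)
    have : |f lam| * lam ^ 2 ≤ lam ^ 3 * |f lam| := by
      rw [mul_comm]; exact mul_le_mul_of_nonneg_right h3 (abs_nonneg _)
    linarith
  have hhlam : |h lam| ≤ B / lam ^ 2 := by
    rw [le_div_iff₀ hl2]; have := hB lam; linarith
  have helam : |f lam - c * h lam| ≤ (A₂ + cM * B) / lam ^ 2 := by
    calc |f lam - c * h lam| ≤ |f lam| + |c * h lam| := abs_sub _ _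
      _ = |f lam| + c * |h lam| := by rw [abs_mul, abs_of_pos hc0]
      _ ≤ A₂ / lam ^ 2 + cM * (B / lam ^ 2) :=
          add_le_add hflam (mul_le_mul hccM hhlam (abs_nonneg _) hcM0)
      _ = (A₂ + cM * B) / lam ^ 2 := by ring
  have hV : ∀ x ∈ Ioo X lam, lam ^ 2 ≤ (2 * π * lam * x) ^ 2 - χ := by
    intro x hx
    have h1 : (2 * π * lam * X) ^ 2 ≤ (2 * π * lam * x) ^ 2 := by
      have := mul_le_mul_of_nonneg_left hx.1.le (by positivity : (0 : ℝ) ≤ 2 * π * lam)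
      exact pow_le_pow_left₀ (by positivity) this 2
    linarith
  have hρ : ∀ x ∈ Ioo X lam,
      |c * ((lam ^ 2 * μ - χ) * h x + (2 * x * h' x + x ^ 2 * ((4 * π ^ 2 * x ^ 2 - μ) * h x)))|
        ≤ W := by
    intro x hx
    rw [abs_mul, abs_of_pos hc0]
    have h1 : |(lam ^ 2 * μ - χ) * h x| ≤ D * H := by
      rw [abs_mul]
      have : |lam ^ 2 * μ - χ| ≤ D := by rw [abs_sub_comm]; exact hDχ
      exact mul_le_mul this (hH x) (abs_nonneg _) hD0
    have h2 := hQ x (by linarith [hx.1])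
    have h3 := (abs_add_le _ _).trans (add_le_add h1 h2)
    rw [hWdef]
    exact mul_le_mul hccM h3 (abs_nonneg _) hcM0
  have hmp := hf.abs_sub_mul_le_max hχ hh hh' (c := c) hX0 (by linarith) hl2 hW0 hV hρ
  -- `|f − c h| ≤ T λ^{-2}` on `[0, λ]`
  have hT : ∀ x ∈ Icc 0 lam, |f x - c * h x| ≤ T / lam ^ 2 := by
    intro x hx
    rcases le_or_gt x X with hxX | hxX
    · exact ((hwin x ⟨hx.1, hxX⟩).1).trans (hdivmono (by rw [hTdef]; linarith))
    · have b1 : |f X - c * h X| ≤ T / lam ^ 2 :=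
        ((hwin X ⟨hX0, le_rfl⟩).1).trans (hdivmono (by rw [hTdef]; linarith))
      have b2 : |f lam - c * h lam| ≤ T / lam ^ 2 :=
        helam.trans (hdivmono (by rw [hTdef]; linarith))
      have b3 : W / lam ^ 2 ≤ T / lam ^ 2 := hdivmono (by rw [hTdef]; linarith)
      exact (hmp x ⟨hxX.le, hx.2⟩).trans (max_le (max_le b1 b2) b3)
  -- Step 5: the scale `|c − 1| = O(λ^{-2})`
  have hIf : ∫ x in (0 : ℝ)..lam, f x ^ 2 = 1 / 2 := hf.integral_sq_half
  have hL1 : (∫ x in (0 : ℝ)..lam, |f x - h x|) ≤ 1 := (hU1 lam hlU f hf).2.1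
  have hcf : ContinuousOn f (Icc 0 lam) :=
    hf.contDiffOn.continuousOn.mono (Icc_subset_Icc (by linarith) le_rfl)
  have hu : uIcc 0 lam = Icc 0 lam := uIcc_of_le hlam0.le
  have ifa : IntervalIntegrable (fun x ↦ |f x|) volume 0 lam :=
    (hcf.abs.mono hu.le).intervalIntegrable
  have iha : IntervalIntegrable (fun x ↦ |h x|) volume 0 lam := hhc.abs.intervalIntegrable _ _
  have hNl : (∫ x in (0 : ℝ)..lam, |h x|) ≤ N := by
    rw [hNdef, intervalIntegral.integral_of_le hlam0.le]
    exact setIntegral_mono_set Ih.abs.integrableOn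
      (Eventually.of_forall fun x ↦ abs_nonneg _) (Eventually.of_forall Ioc_subset_Ioi_self)
  have hfa : (∫ x in (0 : ℝ)..lam, |f x|) ≤ 1 + N := by
    have hpt : ∀ x ∈ Icc 0 lam, |f x| ≤ |f x - h x| + |h x| := fun x _ ↦ by
      have := abs_add_le (f x - h x) (h x); rwa [sub_add_cancel] at this
    have ifh : IntervalIntegrable (fun x ↦ |f x - h x|) volume 0 lam :=
      (((hcf.sub hhc.continuousOn).abs).mono hu.le).intervalIntegrable
    have := intervalIntegral.integral_mono_on hlam0.le ifa (ifh.add iha) hpt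
    rw [intervalIntegral.integral_add ifh iha] at this
    linarith
  obtain ⟨I, hIdef⟩ : ∃ I : ℝ, I = ∫ x in (0 : ℝ)..lam, h x ^ 2 := ⟨_, rfl⟩
  have if2 : IntervalIntegrable (fun x ↦ f x ^ 2) volume 0 lam :=
    ((hcf.pow 2).mono hu.le).intervalIntegrable
  have ih2 : IntervalIntegrable (fun x ↦ h x ^ 2) volume 0 lam := (hhc.pow 2).intervalIntegrable _ _
  have hdiff : (∫ x in (0 : ℝ)..lam, f x ^ 2) - c ^ 2 * I
      = ∫ x in (0 : ℝ)..lam, (f x - c * h x) * (f x + c * h x) := by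
    rw [hIdef, ← intervalIntegral.integral_const_mul,
      ← intervalIntegral.integral_sub if2 (ih2.const_mul _)]
    refine intervalIntegral.integral_congr fun x _ ↦ ?_
    ring
  have hprod : |(∫ x in (0 : ℝ)..lam, f x ^ 2) - c ^ 2 * I| ≤ T₂ / lam ^ 2 := by
    rw [hdiff]
    have hcc : ContinuousOn (fun x ↦ c * h x) (Icc 0 lam) := continuousOn_const.mul hhc.continuousOn
    have ipr : IntervalIntegrable (fun x ↦ (f x - c * h x) * (f x + c * h x)) volume 0 lam :=
      (((hcf.sub hcc).mul (hcf.add hcc)).mono hu.le).intervalIntegrable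
    have ibd : IntervalIntegrable (fun x ↦ T / lam ^ 2 * (|f x| + c * |h x|)) volume 0 lam :=
      (ifa.add (iha.const_mul c)).const_mul _
    have hpt : ∀ x ∈ Icc 0 lam,
        |(f x - c * h x) * (f x + c * h x)| ≤ T / lam ^ 2 * (|f x| + c * |h x|) := by
      intro x hx
      rw [abs_mul]
      refine mul_le_mul (hT x hx) ?_ (abs_nonneg _) (by positivity)
      calc |f x + c * h x| ≤ |f x| + |c * h x| := abs_add_le _ _
        _ = |f x| + c * |h x| := by rw [abs_mul, abs_of_pos hc0]
    have hh0i : 0 ≤ ∫ x in (0 : ℝ)..lam, |h x| :=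
      intervalIntegral.integral_nonneg hlam0.le fun x _ ↦ abs_nonneg _
    calc |∫ x in (0 : ℝ)..lam, (f x - c * h x) * (f x + c * h x)|
        ≤ ∫ x in (0 : ℝ)..lam, |(f x - c * h x) * (f x + c * h x)| :=
          intervalIntegral.abs_integral_le_integral_abs hlam0.le
      _ ≤ ∫ x in (0 : ℝ)..lam, T / lam ^ 2 * (|f x| + c * |h x|) :=
          intervalIntegral.integral_mono_on hlam0.le ipr.abs ibd hpt
      _ = T / lam ^ 2 * ((∫ x in (0 : ℝ)..lam, |f x|) + c * ∫ x in (0 : ℝ)..lam, |h x|) := by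
          rw [intervalIntegral.integral_const_mul, intervalIntegral.integral_add ifa (iha.const_mul c),
            intervalIntegral.integral_const_mul]
      _ ≤ T / lam ^ 2 * ((1 + N) + cM * N) := by
          refine mul_le_mul_of_nonneg_left (add_le_add hfa ?_) (by positivity)
          exact mul_le_mul hccM hNl hh0i hcM0
      _ = T₂ / lam ^ 2 := by rw [hT₂def]; ring
  have hIu : I ≤ 1 / 2 := by
    rw [hIdef]
    exact integral_le_of_tendsto_of_nonneg (hhc.pow 2) (fun x _ ↦ sq_nonneg _) hI hlam0.le
  have hIl : 1 / 2 - B ^ 2 / lam ^ 2 ≤ I := by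
    rw [hIdef]; exact half_sub_le_integral_sq hhc hB hI hlam1
  have hB2 : B ^ 2 / lam ^ 2 ≤ 1 / 4 := by
    rw [div_le_iff₀ hl2]; linarith [sq_nonneg B]
  have hI4 : 1 / 4 ≤ I := by linarith
  have hBl0 : 0 ≤ B ^ 2 / lam ^ 2 := div_nonneg (sq_nonneg B) hl2.le
  have hI2 : |I - 1 / 2| ≤ B ^ 2 / lam ^ 2 := by
    rw [abs_le]; constructor <;> linarith
  have h12 : |1 / 2 - c ^ 2 * I| ≤ T₂ / lam ^ 2 := by rw [← hIf]; exact hprod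
  have hc1 : |c - 1| ≤ 4 * (T₂ / lam ^ 2 + B ^ 2 / lam ^ 2) :=
    abs_sub_one_le_of_sq hc0.le hI4 h12 hI2
  -- Step 6: the bound on `[0, λ]`, then on `[−λ, λ]` by evenness
  have hfin : ∀ x ∈ Icc 0 lam, |f x - h x| ≤ (T + 4 * (T₂ + B ^ 2) * H) / lam ^ 2 := by
    intro x hx
    have e : f x - h x = (f x - c * h x) + (c - 1) * h x := by ring
    rw [e]
    calc |(f x - c * h x) + (c - 1) * h x| ≤ |f x - c * h x| + |(c - 1) * h x| := abs_add_le _ _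
      _ ≤ T / lam ^ 2 + 4 * (T₂ / lam ^ 2 + B ^ 2 / lam ^ 2) * H := by
          rw [abs_mul]
          exact add_le_add (hT x hx) (mul_le_mul hc1 (hH x) (abs_nonneg _) (by positivity))
      _ = (T + 4 * (T₂ + B ^ 2) * H) / lam ^ 2 := by ring
  intro x hx
  rcases le_or_gt 0 x with hx0 | hx0
  · exact hfin x ⟨hx0, hx.2⟩
  · have := hfin (-x) ⟨by linarith, by linarith [hx.1]⟩
    rw [hf.even x, heven x] at this
    exact this

/-! ### The Hermite data: `y^k e^{−y} ≤ k!` (`k = 3, 4`), the decay `x²|h_n| ≤ B_n` and `|(x²h_n′)′| ≤ Q_n` -/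

/-- `y³e^{−y} ≤ 6` and `y⁴e^{−y} ≤ 24` for `y ≥ 0` (`y^k/k! ≤ e^y`). [folklore] -/
theorem cube_mul_exp_neg_le {y : ℝ} (hy : 0 ≤ y) :
    y ^ 3 * Real.exp (-y) ≤ 6 ∧ y ^ 4 * Real.exp (-y) ≤ 24 := by
  have h3 := Real.pow_div_factorial_le_exp y hy 3
  have h4 := Real.pow_div_factorial_le_exp y hy 4
  norm_num [Nat.factorial] at h3 h4
  have he := Real.exp_pos y
  rw [Real.exp_neg]
  constructor
  · rw [mul_inv_le_iff₀ he]; linarith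
  · rw [mul_inv_le_iff₀ he]; linarith

/-- `x²h_0(x) ≤ 2^{1/4}` (`x² ≤ πx²`, `(πx²)e^{−πx²} ≤ 1`). [folklore] -/
theorem sq_mul_abs_hermiteH0_le (x : ℝ) : x ^ 2 * |hermiteH0 x| ≤ (2 : ℝ) ^ ((1 : ℝ) / 4) := by
  rw [abs_of_pos (hermiteH0_pos x)]
  unfold hermiteH0
  have h2 : 0 ≤ (2 : ℝ) ^ ((1 : ℝ) / 4) := (Real.rpow_pos_of_pos two_pos _).le
  have h1 := (mul_exp_neg_le (by positivity : 0 ≤ π * x ^ 2)).1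
  have hee : Real.exp (-π * x ^ 2) = Real.exp (-(π * x ^ 2)) := by ring_nf
  rw [hee]
  have hx2 : x ^ 2 ≤ π * x ^ 2 := le_mul_of_one_le_left (sq_nonneg x) (by linarith [Real.pi_gt_three])
  have he := Real.exp_pos (-(π * x ^ 2))
  calc x ^ 2 * ((2 : ℝ) ^ ((1 : ℝ) / 4) * Real.exp (-(π * x ^ 2)))
      = (2 : ℝ) ^ ((1 : ℝ) / 4) * (x ^ 2 * Real.exp (-(π * x ^ 2))) := by ring
    _ ≤ (2 : ℝ) ^ ((1 : ℝ) / 4) * ((π * x ^ 2) * Real.exp (-(π * x ^ 2))) :=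
        mul_le_mul_of_nonneg_left (mul_le_mul_of_nonneg_right hx2 he.le) h2
    _ ≤ (2 : ℝ) ^ ((1 : ℝ) / 4) * 1 := mul_le_mul_of_nonneg_left h1 h2
    _ = (2 : ℝ) ^ ((1 : ℝ) / 4) := mul_one _

/-- `|(x²h_0′)′| = 2^{1/4}|4π²x⁴ − 6πx²|e^{−πx²} ≤ 14·2^{1/4}`. [folklore] -/
theorem abs_q_hermiteH0_le (x : ℝ) :
    |2 * x * hermiteH0' x + x ^ 2 * ((4 * π ^ 2 * x ^ 2 - 2 * π) * hermiteH0 x)|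
      ≤ 14 * (2 : ℝ) ^ ((1 : ℝ) / 4) := by
  have h2 : 0 ≤ (2 : ℝ) ^ ((1 : ℝ) / 4) := (Real.rpow_pos_of_pos two_pos _).le
  obtain ⟨h1, h1'⟩ := mul_exp_neg_le (by positivity : 0 ≤ π * x ^ 2)
  have hee : Real.exp (-π * x ^ 2) = Real.exp (-(π * x ^ 2)) := by ring_nf
  have he := Real.exp_pos (-(π * x ^ 2))
  have e : 2 * x * hermiteH0' x + x ^ 2 * ((4 * π ^ 2 * x ^ 2 - 2 * π) * hermiteH0 x)
      = (2 : ℝ) ^ ((1 : ℝ) / 4)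
        * ((4 * (π * x ^ 2) ^ 2 - 6 * (π * x ^ 2)) * Real.exp (-(π * x ^ 2))) := by
    simp only [hermiteH0, hermiteH0', hee]; ring
  rw [e, abs_mul, abs_of_nonneg h2, abs_mul, abs_of_pos he]
  have hy : 0 ≤ π * x ^ 2 := by positivity
  have hP : |4 * (π * x ^ 2) ^ 2 - 6 * (π * x ^ 2)| ≤ 4 * (π * x ^ 2) ^ 2 + 6 * (π * x ^ 2) := by
    rw [abs_le]; constructor <;> nlinarith [sq_nonneg (π * x ^ 2)]
  calc (2 : ℝ) ^ ((1 : ℝ) / 4) * (|4 * (π * x ^ 2) ^ 2 - 6 * (π * x ^ 2)| * Real.exp (-(π * x ^ 2)))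
      ≤ (2 : ℝ) ^ ((1 : ℝ) / 4)
        * ((4 * (π * x ^ 2) ^ 2 + 6 * (π * x ^ 2)) * Real.exp (-(π * x ^ 2))) :=
        mul_le_mul_of_nonneg_left (mul_le_mul_of_nonneg_right hP he.le) h2
    _ = (2 : ℝ) ^ ((1 : ℝ) / 4) * (4 * ((π * x ^ 2) ^ 2 * Real.exp (-(π * x ^ 2)))
        + 6 * ((π * x ^ 2) * Real.exp (-(π * x ^ 2)))) := by ring
    _ ≤ (2 : ℝ) ^ ((1 : ℝ) / 4) * (4 * 2 + 6 * 1) := by gcongr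
    _ = 14 * (2 : ℝ) ^ ((1 : ℝ) / 4) := by ring

/-- `x²|h_4(x)| ≤ 147/(16A)` (`x²|16π²x⁴ − 24πx² + 3| ≤ 16y³ + 24y² + 3y`, `y = πx²`, and
`y^k e^{−y} ≤ k!`). [folklore] -/
theorem sq_mul_abs_hermiteH4_le (x : ℝ) : x ^ 2 * |hermiteH4 x| ≤ 147 / (16 * prolateGuessA) := by
  have hA := prolateGuessA_pos
  have hee : Real.exp (-π * x ^ 2) = Real.exp (-(π * x ^ 2)) := by ring_nf
  have he := Real.exp_pos (-(π * x ^ 2))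
  have hy : 0 ≤ π * x ^ 2 := by positivity
  obtain ⟨h1, h2⟩ := mul_exp_neg_le hy
  have h3 : (π * x ^ 2) ^ 3 * Real.exp (-(π * x ^ 2)) ≤ 6 := (cube_mul_exp_neg_le hy).1
  have hx2 : x ^ 2 ≤ π * x ^ 2 := le_mul_of_one_le_left (sq_nonneg x) (by linarith [Real.pi_gt_three])
  unfold hermiteH4
  rw [hee, abs_div, abs_of_pos (by positivity : (0 : ℝ) < 16 * prolateGuessA), abs_mul,
    abs_of_pos he, ← mul_div_assoc, div_le_div_iff_of_pos_right (by positivity)]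
  have hP : |16 * π ^ 2 * x ^ 4 - 24 * π * x ^ 2 + 3| ≤ 16 * (π * x ^ 2) ^ 2 + 24 * (π * x ^ 2) + 3 := by
    rw [abs_le]; constructor <;> nlinarith [sq_nonneg (π * x ^ 2)]
  calc x ^ 2 * (|16 * π ^ 2 * x ^ 4 - 24 * π * x ^ 2 + 3| * Real.exp (-(π * x ^ 2)))
      ≤ (π * x ^ 2) * ((16 * (π * x ^ 2) ^ 2 + 24 * (π * x ^ 2) + 3) * Real.exp (-(π * x ^ 2))) :=
        mul_le_mul hx2 (mul_le_mul_of_nonneg_right hP he.le) (by positivity) hy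
    _ = 16 * ((π * x ^ 2) ^ 3 * Real.exp (-(π * x ^ 2)))
        + 24 * ((π * x ^ 2) ^ 2 * Real.exp (-(π * x ^ 2)))
        + 3 * ((π * x ^ 2) * Real.exp (-(π * x ^ 2))) := by ring
    _ ≤ 16 * 6 + 24 * 2 + 3 * 1 := by gcongr
    _ = 147 := by norm_num

/-- `|(x²h_4′)′| = |64y⁴ − 448y³ + 668y² − 162y|e^{−y}/(16A) ≤ 5722/(16A)` (`y = πx²`).
[folklore] -/
theorem abs_q_hermiteH4_le (x : ℝ) :
    |2 * x * hermiteH4' x + x ^ 2 * ((4 * π ^ 2 * x ^ 2 - 18 * π) * hermiteH4 x)|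
      ≤ 5722 / (16 * prolateGuessA) := by
  have hA := prolateGuessA_pos
  have hee : Real.exp (-π * x ^ 2) = Real.exp (-(π * x ^ 2)) := by ring_nf
  have he := Real.exp_pos (-(π * x ^ 2))
  have hy : 0 ≤ π * x ^ 2 := by positivity
  obtain ⟨h1, h2⟩ := mul_exp_neg_le hy
  have h3 : (π * x ^ 2) ^ 3 * Real.exp (-(π * x ^ 2)) ≤ 6 := (cube_mul_exp_neg_le hy).1
  have h4 : (π * x ^ 2) ^ 4 * Real.exp (-(π * x ^ 2)) ≤ 24 := (cube_mul_exp_neg_le hy).2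
  have e : 2 * x * hermiteH4' x + x ^ 2 * ((4 * π ^ 2 * x ^ 2 - 18 * π) * hermiteH4 x)
      = (64 * (π * x ^ 2) ^ 4 - 448 * (π * x ^ 2) ^ 3 + 668 * (π * x ^ 2) ^ 2 - 162 * (π * x ^ 2))
        * Real.exp (-(π * x ^ 2)) / (16 * prolateGuessA) := by
    simp only [hermiteH4, hermiteH4', hee]; ring
  rw [e, abs_div, abs_of_pos (by positivity : (0 : ℝ) < 16 * prolateGuessA), abs_mul,
    abs_of_pos he, div_le_div_iff_of_pos_right (by positivity)]
  have hP : |64 * (π * x ^ 2) ^ 4 - 448 * (π * x ^ 2) ^ 3 + 668 * (π * x ^ 2) ^ 2 - 162 * (π * x ^ 2)|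
      ≤ 64 * (π * x ^ 2) ^ 4 + 448 * (π * x ^ 2) ^ 3 + 668 * (π * x ^ 2) ^ 2 + 162 * (π * x ^ 2) := by
    have p3 : 0 ≤ (π * x ^ 2) ^ 3 := by positivity
    have p4 : 0 ≤ (π * x ^ 2) ^ 4 := by positivity
    rw [abs_le]; constructor <;> nlinarith [sq_nonneg (π * x ^ 2)]
  calc |64 * (π * x ^ 2) ^ 4 - 448 * (π * x ^ 2) ^ 3 + 668 * (π * x ^ 2) ^ 2 - 162 * (π * x ^ 2)|
        * Real.exp (-(π * x ^ 2))
      ≤ (64 * (π * x ^ 2) ^ 4 + 448 * (π * x ^ 2) ^ 3 + 668 * (π * x ^ 2) ^ 2 + 162 * (π * x ^ 2))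
        * Real.exp (-(π * x ^ 2)) := mul_le_mul_of_nonneg_right hP he.le
    _ = 64 * ((π * x ^ 2) ^ 4 * Real.exp (-(π * x ^ 2)))
        + 448 * ((π * x ^ 2) ^ 3 * Real.exp (-(π * x ^ 2)))
        + 668 * ((π * x ^ 2) ^ 2 * Real.exp (-(π * x ^ 2)))
        + 162 * ((π * x ^ 2) * Real.exp (-(π * x ^ 2))) := by ring
    _ ≤ 64 * 24 + 448 * 6 + 668 * 2 + 162 * 1 := by gcongr
    _ = 5722 := by norm_num

/-! ### CCM25 Lemma 7.2(i) for `n = 0` and `n = 4`, and Fact 6.4 by the printed route -/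

/-- **The eigenvalue to `O(1)`, `n = 0`:** `|χ_0(λ) − 2πλ²| ≤ D` for `λ ≥ Λ`.
[cite: ConnesConsaniMoscovici2025, Lemma 7.2; SlepianPollak1961, §III] -/
theorem IsProlateFunction.eigen_sub_le_of_zero : ∃ D Λ : ℝ, 0 ≤ D ∧ ∀ lam : ℝ, Λ ≤ lam →
    ∀ (f : ℝ → ℝ) (χ : ℝ), IsProlateFunction lam 0 f →
      (∀ x ∈ Ioo (-lam) lam, -(deriv (fun y ↦ (lam ^ 2 - y ^ 2) * deriv f y) x)
        + (2 * π * lam * x) ^ 2 * f x = χ * f x) → |χ - lam ^ 2 * (2 * π)| ≤ D :=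
  eigen_sub_le_of_supClose hasDerivAt_hermiteH0 hasDerivAt_hermiteH0' hermiteH0'_zero
    abs_hermiteH0_le integrable_hermiteH0 integrableOn_abs_q_hermiteH0 integral_sq_hermiteH0_pos
    (IsProlateFunction.supClose_of_uniform_limits hasDerivAt_hermiteH0 continuous_hermiteH0'
      hermiteH0_even sq_mul_abs_hermiteH0_le IsProlateFunction.uniform_limits_zero)

/-- **The eigenvalue to `O(1)`, `n = 4`:** `|χ_4(λ) − 18πλ²| ≤ D` for `λ ≥ Λ`.
[cite: ConnesConsaniMoscovici2025, Lemma 7.2; SlepianPollak1961, §III] -/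
theorem IsProlateFunction.eigen_sub_le_of_four : ∃ D Λ : ℝ, 0 ≤ D ∧ ∀ lam : ℝ, Λ ≤ lam →
    ∀ (f : ℝ → ℝ) (χ : ℝ), IsProlateFunction lam 4 f →
      (∀ x ∈ Ioo (-lam) lam, -(deriv (fun y ↦ (lam ^ 2 - y ^ 2) * deriv f y) x)
        + (2 * π * lam * x) ^ 2 * f x = χ * f x) → |χ - lam ^ 2 * (18 * π)| ≤ D :=
  eigen_sub_le_of_supClose hasDerivAt_hermiteH4 hasDerivAt_hermiteH4' hermiteH4'_zero
    abs_hermiteH4_le integrable_hermiteH4 integrableOn_abs_q_hermiteH4 integral_sq_hermiteH4_pos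
    (IsProlateFunction.supClose_of_uniform_limits hasDerivAt_hermiteH4 continuous_hermiteH4'
      hermiteH4_even sq_mul_abs_hermiteH4_le IsProlateFunction.uniform_limits_four)

/-- **CCM25 Lemma 7.2(i), eq. (7.7), `n = 0` — PROVED:** `max_{[−λ,λ]}|h_{0,λ} − h_0| ≤ Cλ^{-2}`
for `λ ≥ Λ`, for every `L²`-normalised prolate function with no zeros (`prolateSupNormRate 0
hermiteH0`, formerly a cite-tagged named fact of `ConnesProlateGuessFact.lean`).
[cite: ConnesConsaniMoscovici2025, Lemma 7.2; SlepianPollak1961, §III] -/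
theorem prolateSupNormRate_zero : prolateSupNormRate 0 hermiteH0 :=
  prolateSupNormRate_of_uniform_limits (n := 0) (μ := 2 * π) (by linarith [Real.pi_gt_three])
    hasDerivAt_hermiteH0 hasDerivAt_hermiteH0' (hermiteH0_pos 0) hermiteH0'_zero hermiteH0_even
    abs_hermiteH0_le integrable_hermiteH0 integral_sq_hermiteH0_pos integrableOn_abs_q_hermiteH0
    (fun x _ ↦ abs_q_hermiteH0_le x) sq_mul_abs_hermiteH0_le tendsto_integral_sq_hermiteH0
    IsProlateFunction.uniform_limits_zero

/-- **CCM25 Lemma 7.2(i), eq. (7.7), `n = 4` — PROVED:** `max_{[−λ,λ]}|h_{4,λ} − h_4| ≤ Cλ^{-2}`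
for `λ ≥ Λ`, for every `L²`-normalised prolate function with four zeros (`prolateSupNormRate 4
hermiteH4`). [cite: ConnesConsaniMoscovici2025, Lemma 7.2; SlepianPollak1961, §III] -/
theorem prolateSupNormRate_four : prolateSupNormRate 4 hermiteH4 :=
  prolateSupNormRate_of_uniform_limits (n := 4) (μ := 18 * π) (by linarith [Real.pi_gt_three])
    hasDerivAt_hermiteH4 hasDerivAt_hermiteH4' hermiteH4_zero_pos hermiteH4'_zero hermiteH4_even
    abs_hermiteH4_le integrable_hermiteH4 integral_sq_hermiteH4_pos integrableOn_abs_q_hermiteH4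
    (fun x _ ↦ abs_q_hermiteH4_le x) sq_mul_abs_hermiteH4_le tendsto_integral_sq_hermiteH4
    IsProlateFunction.uniform_limits_four

/- **Connes' Fact 6.4 (= CCM25 Lemma 7.3) by the PRINTED route, now hypothesis-free.**  The
prolate guess converges to `Ξ` locally uniformly on `|Re s| < 1/2`
(`prolateGuess_tendsto_riemannXi`): `prolateGuess_tendsto_riemannXi_of_supNormRate` with both
sup-norm inputs discharged by `prolateSupNormRate_zero/four`.  The statement itself is already the
landed theorem `prolateGuess_tendsto_riemannXi_rhFree` (`ConnesProlateGuessRHFree.lean`, the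
`W^{1,1}` route), so this second proof is recorded as a kernel-checked `example`, not a new
declaration.  THIS IS NOT AN RH STATEMENT.
[cite: Connes2026Letter, Fact 6.4; ConnesConsaniMoscovici2025, Lemma 7.2, Lemma 7.3] -/
example : prolateGuess_tendsto_riemannXi :=
  prolateGuess_tendsto_riemannXi_of_supNormRate prolateSupNormRate_zero prolateSupNormRate_four

end Literature.NumberTheory.LFunctions
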